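import Summits.Langlands.Langlands.Theorems.PhantomRMYoshidaResiduallyYoshidaLiftingNonsplitInvariantSubspaces
import Summits.Langlands.Langlands.Theorems.PhantomRMYoshidaResiduallyYoshidaLiftingNonsplitCommutant
import HarnessLib

/-!
# No stable hyperplane of a realiser of a non-trivial class (stub `stub_noStableCovector`) — line `sector-klingen-split`

Stub-worker of lead prover-line-stmt-Langlands-13639-c4-0 (continuation c4, 2026-08-17), crux `ResiduallyYoshidaLifting`
(stmt-Langlands-13639), skeleton rev 7, sub-goal T3.

**Statement (`stub_noStableCovector`).**  Let `rint : Γ → GL₄(ℤ̄_p)` (`ℤ̄_p = 𝒪[ℚ̄_p]`, `ℚ̄_p = PadicAlgCl p`) be an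
integral frame whose reduction through `red : ℤ̄_p → k` is `h (σ, B; 0, σ') h⁻¹` with `σ, σ'` irreducible and `B` NOT a
coboundary.  Then `rint` has no stable HYPERPLANE over `ℚ̄_p`, phrased dually: there is no common ROW eigenvector
`w ≠ 0`, `w ᵥ* rint g = c_g • w` for all `g`.

**Proof.**  Rescale `w` by a coordinate `q = w i` of maximal norm: `q⁻¹ • w` is integral with `i`-th coordinate `1` and
is still a row eigenvector; its eigenvalues `c_g = (q⁻¹ • w ᵥ* rint g) i` are then integral, so the eigen-equation
holds over `ℤ̄_p` and reduces through `red` to `w̄ ᵥ* ρ̄(g) = c̄_g • w̄` with `w̄ i = 1`, `ρ̄ = h (σ, B; 0, σ') h⁻¹`.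
The row vector `w' = w̄ ᵥ* h ≠ 0` (re-indexed along `finSumFinEquiv`) is a row eigenvector of every
`(σ g, B g; 0, σ' g)`, so its kernel `W = {x | w' ⬝ᵥ x = 0}` is a stable subspace of `k² ⊕ k²`.  By the trichotomy
`stub_nonsplitInvariantSubspaces` (p152467), `W` is `⊥`, `⊤` or the `σ`-plane `{x | x|inr = 0}`; but `W ≠ ⊤` as
`w' ≠ 0`, and `W` always contains a vector with a non-zero `inr`-coordinate (`e_{inr 0}` if `w'_{inr 0} = 0`, else
`w'_{inr 0} e_{inr 1} - w'_{inr 1} e_{inr 0}`), which excludes `⊥` and the `σ`-plane.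
-/

noncomputable section

open scoped MatrixGroups Matrix

set_option linter.dupNamespace false
set_option autoImplicit false

namespace Summit.Langlands.Langlands.Cruxes.ResiduallyYoshidaLifting.SectorKlingenSplit.Fibre

open Summit.Langlands.Langlands.Cruxes.ResiduallyYoshidaLifting.EndoscopicCrossingEuler
open Summit.Langlands.Langlands.Cruxes.ResiduallyYoshidaLifting.SectorKlingenSplit.Ribet
open Literature.NumberTheory.GaloisRepresentations

/-! ### Linear algebra on `k² ⊕ k²` -/

section LinAlg

variable {k : Type*} [Field k]

/-- Every covector `w` on `k² ⊕ k²` kills some vector with a non-zero `inr`-coordinate: the kernel of a functional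
has dimension `≥ 3 > 2 = dim` of the `inl`-plane. [folklore] -/
theorem exists_dotProduct_eq_zero_inr_ne_zero (w : Fin 2 ⊕ Fin 2 → k) :
    ∃ x : Fin 2 ⊕ Fin 2 → k, w ⬝ᵥ x = 0 ∧ ∃ j : Fin 2, x (Sum.inr j) ≠ 0 := by
  by_cases h0 : w (Sum.inr 0) = 0
  · refine ⟨Pi.single (Sum.inr 0) 1, ?_, 0, ?_⟩
    · rw [dotProduct_single, mul_one, h0]
    · simp
  · refine ⟨Pi.single (Sum.inr 1) (w (Sum.inr 0)) - Pi.single (Sum.inr 0) (w (Sum.inr 1)), ?_, 1, ?_⟩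
    · rw [dotProduct_sub, dotProduct_single, dotProduct_single]
      ring
    · simpa using h0

/-- The kernel `{x | w ⬝ᵥ x = 0}` of a covector, as a submodule. [folklore] -/
theorem exists_submodule_dotProduct_eq_zero {ι : Type*} [Fintype ι] (w : ι → k) :
    ∃ W : Submodule k (ι → k), ∀ x, x ∈ W ↔ w ⬝ᵥ x = 0 := by
  let φ : (ι → k) →ₗ[k] k :=
    { toFun := fun x => w ⬝ᵥ x
      map_add' := fun x y => dotProduct_add w x y
      map_smul' := fun c x => dotProduct_smul c w x }
  exact ⟨LinearMap.ker φ, fun x => LinearMap.mem_ker⟩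

/-- A row eigenvector `w'` of every `(σ g, B g; 0, σ' g)` with `σ, σ'` irreducible and `B` not a coboundary vanishes:
its kernel would be a stable hyperplane, excluded by the trichotomy `stub_nonsplitInvariantSubspaces`. [folklore] -/
theorem rowEigenvector_fromBlocks_eq_zero {k : Type} [Field k] {Γ : Type} [Group Γ] (σ σ' : Γ →* GL (Fin 2) k)
    (hσ : Representation.IsIrreducible ((glStdRepresentation (Fin 2) k).comp σ))
    (hσ' : Representation.IsIrreducible ((glStdRepresentation (Fin 2) k).comp σ'))
    (B : Γ → Matrix (Fin 2) (Fin 2) k)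
    (hB : ¬ ∃ X : Matrix (Fin 2) (Fin 2) k, ∀ g, B g = (σ g).val * X - X * (σ' g).val)
    (w' : Fin 2 ⊕ Fin 2 → k)
    (hw' : ∀ g, ∃ c : k, w' ᵥ* Matrix.fromBlocks (σ g).val (B g) 0 (σ' g).val = c • w') :
    w' = 0 := by
  by_contra hne
  obtain ⟨W, hW⟩ := exists_submodule_dotProduct_eq_zero w'
  have hstab : ∀ g, ∀ x ∈ W, (Matrix.fromBlocks (σ g).val (B g) 0 (σ' g).val) *ᵥ x ∈ W := by
    intro g x hx
    obtain ⟨c, hc⟩ := hw' g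
    rw [hW] at hx ⊢
    rw [Matrix.dotProduct_mulVec, hc, smul_dotProduct, hx, smul_zero]
  obtain ⟨x, hx0, j, hxj⟩ := exists_dotProduct_eq_zero_inr_ne_zero w'
  have hxW : x ∈ W := (hW x).2 hx0
  rcases stub_nonsplitInvariantSubspaces k Γ σ σ' hσ hσ' B hB W hstab with hbot | htop | hplane
  · rw [hbot, Submodule.mem_bot] at hxW
    exact hxj (by rw [hxW]; rfl)
  · obtain ⟨a, ha⟩ := Function.ne_iff.1 hne
    have hmem : Pi.single a (1 : k) ∈ W := by
      rw [htop]
      exact Submodule.mem_top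
    rw [hW, dotProduct_single, mul_one] at hmem
    exact ha hmem
  · exact hxj (((hplane x).1 hxW) j)

end LinAlg

/-! ### Integral rescaling of a row eigenvector and reduction -/

section Integral

variable {p : ℕ} [Fact p.Prime]

/-- **Primitive rescaling of a row eigenvector.**  A non-zero common row eigenvector `w` over `ℚ̄_p` of integral matrices
`rint g` may be replaced by an INTEGRAL one with a coordinate equal to `1`, whose eigen-equations hold over `ℤ̄_p`
(divide by a coordinate of maximal norm; the eigenvalue is the `i`-th coordinate of `w ᵥ* rint g`). [folklore] -/
theorem exists_integral_rowEigenvector {Γ : Type*} (rint : Γ → GL (Fin 4) (Valued.integer (PadicAlgCl p)))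
    (w : Fin 4 → PadicAlgCl p) (hw0 : w ≠ 0)
    (hw : ∀ g, ∃ c : PadicAlgCl p,
      w ᵥ* (Matrix.GeneralLinearGroup.map (Valued.integer (PadicAlgCl p)).subtype (rint g)).val = c • w) :
    ∃ (w₁ : Fin 4 → Valued.integer (PadicAlgCl p)) (i : Fin 4), w₁ i = 1 ∧
      ∀ g, ∃ c : Valued.integer (PadicAlgCl p), w₁ ᵥ* (rint g).val = c • w₁ := by
  set sub := (Valued.integer (PadicAlgCl p)).subtype with hsubdef
  obtain ⟨i, -, hmax⟩ := Finset.exists_max_image (Finset.univ : Finset (Fin 4)) (fun j => ‖w j‖)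
    Finset.univ_nonempty
  set q : PadicAlgCl p := w i with hq
  have hle : ∀ j, ‖w j‖ ≤ ‖q‖ := fun j => hmax j (Finset.mem_univ _)
  have hq0 : q ≠ 0 := fun h0 => by
    apply hw0
    funext j
    have hj := hle j
    rw [h0, norm_zero] at hj
    exact norm_le_zero_iff.1 hj
  have hmem : ∀ j, w j / q ∈ Valued.integer (PadicAlgCl p) := fun j => by
    rw [mem_integer_iff_norm_le_one, norm_div]
    exact div_le_one_of_le₀ (hle j) (norm_nonneg _)
  set w₁ : Fin 4 → Valued.integer (PadicAlgCl p) := fun j => ⟨w j / q, hmem j⟩ with hw₁def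
  have hw₁ : (sub ∘ w₁) = q⁻¹ • w := by
    funext j
    change w j / q = q⁻¹ * w j
    rw [div_eq_inv_mul]
  have hw₁i : w₁ i = 1 := Subtype.ext (div_self hq0)
  refine ⟨w₁, i, hw₁i, fun g => ⟨(w₁ ᵥ* (rint g).val) i, ?_⟩⟩
  obtain ⟨c, hc⟩ := hw g
  -- the eigen-equation of `q⁻¹ • w`, coordinatewise through `sub`
  have hc' : w ᵥ* ((rint g).val.map sub) = c • w := hc
  have key : ∀ j, sub ((w₁ ᵥ* (rint g).val) j) = c * sub (w₁ j) := fun j => by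
    have e1 : sub (w₁ j) = (q⁻¹ • w) j := by
      rw [← hw₁]
      rfl
    rw [RingHom.map_vecMul, hw₁, Matrix.smul_vecMul, e1, hc', Pi.smul_apply, Pi.smul_apply, Pi.smul_apply,
      smul_eq_mul, smul_eq_mul, smul_eq_mul]
    ring
  have hci : sub ((w₁ ᵥ* (rint g).val) i) = c := by
    rw [key, hw₁i, map_one, mul_one]
  funext j
  apply Subtype.val_injective
  change sub ((w₁ ᵥ* (rint g).val) j) = sub ((w₁ ᵥ* (rint g).val) i * w₁ j)
  rw [map_mul, hci, key]

end Integral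

/-! ### Registered form -/

/-- **Registered statement `stub_noStableCovector`** (crux stmt-Langlands-13639, line `sector-klingen-split`, skeleton rev 7,
sub-goal T3): a realiser of a NON-trivial class has no stable HYPERPLANE — no common row eigenvector `w ≠ 0` of the frame
`rint` over `ℚ̄_p`: its primitive reduction `w̄ ≠ 0` would cut a stable hyperplane `ker (w̄ h)` of the non-split
`(σ, B; 0, σ')`, excluded by the trichotomy (p152467). [folklore] -/
theorem stub_noStableCovector :
    ∀ (p : ℕ) [Fact p.Prime] (k : Type) [Field k] (Γ : Type) [Group Γ]
      (red : Valued.integer (PadicAlgCl p) →+* k) (σ σ' : Γ →* GL (Fin 2) k),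
      Representation.IsIrreducible ((glStdRepresentation (Fin 2) k).comp σ) →
      Representation.IsIrreducible ((glStdRepresentation (Fin 2) k).comp σ') →
      ∀ (B : Γ → Matrix (Fin 2) (Fin 2) k),
      (¬ ∃ X : Matrix (Fin 2) (Fin 2) k, ∀ g, B g = (σ g).val * X - X * (σ' g).val) →
      ∀ (rint : Γ → GL (Fin 4) (Valued.integer (PadicAlgCl p))) (h : GL (Fin 4) k),
      (∀ g, (Matrix.GeneralLinearGroup.map red (rint g)).val =
          h.val * Matrix.reindex finSumFinEquiv finSumFinEquiv
            (Matrix.fromBlocks (σ g).val (B g) 0 (σ' g).val) * (h⁻¹).val) →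
      ¬ ∃ w : Fin 4 → PadicAlgCl p, w ≠ 0 ∧ ∀ g, ∃ c : PadicAlgCl p,
          w ᵥ* (Matrix.GeneralLinearGroup.map (Valued.integer (PadicAlgCl p)).subtype (rint g)).val = c • w := by
  intro p _ k _ Γ _ red σ σ' hσ hσ' B hB rint h hred
  rintro ⟨w, hw0, hw⟩
  -- (1) integral primitive row eigenvector
  obtain ⟨w₁, i, hw₁i, hw₁⟩ := exists_integral_rowEigenvector rint w hw0 hw
  -- (2) reduce through `red`
  set wb : Fin 4 → k := red ∘ w₁ with hwbdef
  have hwbi : wb i = 1 := by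
    change red (w₁ i) = 1
    rw [hw₁i, map_one]
  have hwb : ∀ g, ∃ c : k, wb ᵥ* (Matrix.GeneralLinearGroup.map red (rint g)).val = c • wb := fun g => by
    obtain ⟨c, hc⟩ := hw₁ g
    refine ⟨red c, ?_⟩
    funext j
    change ((red ∘ w₁) ᵥ* ((rint g).val.map red)) j = red c * red (w₁ j)
    rw [← RingHom.map_vecMul, hc, ← map_mul]
    rfl
  -- (3) transport by `h`: `w' = wb ᵥ* h` is a row eigenvector of the re-indexed block forms
  set e : Fin 2 ⊕ Fin 2 ≃ Fin 4 := finSumFinEquiv with hedef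
  set w' : Fin 2 ⊕ Fin 2 → k := (wb ᵥ* h.val) ∘ e with hw'def
  have hw' : ∀ g, ∃ c : k, w' ᵥ* Matrix.fromBlocks (σ g).val (B g) 0 (σ' g).val = c • w' := fun g => by
    obtain ⟨c, hc⟩ := hwb g
    refine ⟨c, ?_⟩
    rw [hred g] at hc
    have h1 : (wb ᵥ* h.val) ᵥ* Matrix.reindex e e (Matrix.fromBlocks (σ g).val (B g) 0 (σ' g).val) =
        c • (wb ᵥ* h.val) := by
      have h2 := congrArg (fun v => v ᵥ* h.val) hc
      rw [Matrix.vecMul_vecMul, Units.inv_mul_cancel_right, ← Matrix.vecMul_vecMul, Matrix.smul_vecMul] at h2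
      exact h2
    rw [Matrix.reindex_apply, Matrix.submatrix_vecMul_equiv, Equiv.symm_symm] at h1
    funext x
    have h3 := congrFun h1 (e x)
    simp only [Function.comp_apply, Equiv.symm_apply_apply, Pi.smul_apply] at h3
    rw [h3]
    rfl
  -- (4) the trichotomy kills `w'`, hence `wb`, contradicting `wb i = 1`
  have hw'0 : w' = 0 := rowEigenvector_fromBlocks_eq_zero σ σ' hσ hσ' B hB w' hw'
  have hwbh : wb ᵥ* h.val = 0 := by
    funext y
    have := congrFun hw'0 (e.symm y)
    simpa [hw'def] using this
  have hwb0 : wb = 0 := by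
    have : wb = (wb ᵥ* h.val) ᵥ* (h⁻¹).val := by
      rw [Matrix.vecMul_vecMul, Units.mul_inv, Matrix.vecMul_one]
    rw [this, hwbh, Matrix.zero_vecMul]
  have : (1 : k) = 0 := by rw [← hwbi, hwb0]; rfl
  exact one_ne_zero this

end Summit.Langlands.Langlands.Cruxes.ResiduallyYoshidaLifting.SectorKlingenSplit.Fibre

end
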